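import Summits.Ventures.HodgeRepro2.T5SU11UnipotentSubgroup

/-!
# The Iwasawa decomposition `SU(1,1) = N A K = K A N`

With `K = {rot u}` (the stabiliser of `0`), `A = {a_t = su11 (cosh t) (sinh t)}` (`T5SU11Cartan.hyp`) and
`N = {n_t = su11 (1 + i t) (-i t)}` (`T5SU11UnipotentSubgroup.unip`): the group `N A` acts TRANSITIVELY on
the disc — for `z = x + i y ∈ 𝔻` the point `(n_s a_t) · 0` equals `z` for `τ = tanh t = x - y²/(1-x)`
and `s (1 - τ) = -y/(1-x)` (`exists_orbit_unip_mul_hyp_eq`: the explicit inverse of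
`(n_s a_t) · 0 = (τ - i s(1-τ)) / (1 - i s(1-τ))`) — and since the stabiliser of `0` is `K`
(`T5SU11Fibration.exists_rot_of_orbit_eq_zero`), every `g ∈ SU(1,1)` is `n_s a_t rot u`
(`exists_unip_mul_hyp_mul_rot`, `G = N A K`) and, by inversion, `rot u a_t n_s`
(`exists_rot_mul_hyp_mul_unip`, `G = K A N`). Beside the Cartan decomposition `G = K A⁺ K` of
`T5SU11Cartan`, this is the second classical decomposition of `SU(1,1)` in the tree. Nothing is claimed
about (N).

Blind lane: Mathlib + the HodgeRepro2 prefix only; no sorry; axioms ⊆ {propext, Classical.choice,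
Quot.sound}.
-/

namespace Summit.Ventures.HodgeRepro2.T5SU11Iwasawa

open Metric Filter Topology Set Complex
open T5UnitaryBound T5PoincareDensity T5PoincareInvariance T5SU11Unimodular T5SU11Fibration
  T5SU11Cartan T5SU11OneParameter T5BergmanCoefficient T5SU11UnipotentSubgroup

/-! ### `tanh` is onto `(-1, 1)` -/

/-- `tanh (arsinh (τ / √(1 - τ²))) = τ` for `-1 < τ < 1`. -/
lemma tanh_arsinh_div_sqrt {τ : ℝ} (h1 : -1 < τ) (h2 : τ < 1) :
    Real.tanh (Real.arsinh (τ / Real.sqrt (1 - τ ^ 2))) = τ := by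
  have hpos : 0 < 1 - τ ^ 2 := by nlinarith
  have hs : 0 < Real.sqrt (1 - τ ^ 2) := Real.sqrt_pos.2 hpos
  rw [Real.tanh_eq_sinh_div_cosh, Real.sinh_arsinh, Real.cosh_arsinh]
  have e : 1 + (τ / Real.sqrt (1 - τ ^ 2)) ^ 2 = 1 / (1 - τ ^ 2) := by
    rw [div_pow, Real.sq_sqrt hpos.le]
    field_simp
    ring
  rw [e, one_div, Real.sqrt_inv]
  field_simp

/-- `orbit 1 = 0`. -/
lemma orbit_one : orbit (1 : SU11) = 0 := by
  rw [← map_one rot, orbit_rot]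

/-! ### The orbit of `0` under `n_s` -/

/-- The Möbius action of `n_s`: `n_s · w = ((1 + i s) w - i s) / (i s w + (1 - i s))`. -/
lemma mobius_unip_apply (s : ℝ) (w : ℂ) :
    mobius (mat (unip s)) w =
      ((1 + (s : ℂ) * I) * w - (s : ℂ) * I) / ((s : ℂ) * I * w + (1 - (s : ℂ) * I)) := by
  rw [mat_unip, mobius_su11]
  simp only [map_neg, map_mul, map_add, map_one, Complex.conj_ofReal, Complex.conj_I]
  ring_nf

/-! ### `N A` acts transitively on the disc -/

/-- **`N A` acts transitively on the disc**: for `z ∈ 𝔻` there are `s, t ∈ ℝ` with `(n_s a_t) · 0 = z`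
(explicitly `τ = tanh t = x - y²/(1-x)` and `s (1 - τ) = -y/(1-x)` for `z = x + i y`). -/
theorem exists_orbit_unip_mul_hyp_eq {z : ℂ} (hz : z ∈ ball (0 : ℂ) 1) :
    ∃ s t : ℝ, orbit (unip s * hyp t) = z := by
  have hn : z.re ^ 2 + z.im ^ 2 < 1 := by
    have h1 := mem_ball_zero_iff.mp hz
    have h2 : ‖z‖ ^ 2 < 1 := by nlinarith [norm_nonneg z]
    rw [Complex.sq_norm, Complex.normSq_apply] at h2
    nlinarith [h2]
  have hx1 : z.re < 1 := by nlinarith [sq_nonneg z.im]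
  have h1x : 0 < 1 - z.re := by linarith
  have hτ1 : z.re - z.im ^ 2 / (1 - z.re) < 1 := by
    have : 0 ≤ z.im ^ 2 / (1 - z.re) := div_nonneg (sq_nonneg _) h1x.le
    linarith
  have hτ2 : -1 < z.re - z.im ^ 2 / (1 - z.re) := by
    have : z.im ^ 2 / (1 - z.re) < 1 + z.re := by
      rw [div_lt_iff₀ h1x]
      nlinarith
    linarith
  have h1τ : 0 < 1 - (z.re - z.im ^ 2 / (1 - z.re)) := by linarith
  obtain ⟨τ, hτ⟩ : ∃ τ : ℝ, τ = z.re - z.im ^ 2 / (1 - z.re) := ⟨_, rfl⟩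
  obtain ⟨u, hu⟩ : ∃ u : ℝ, u = -z.im / (1 - z.re) := ⟨_, rfl⟩
  obtain ⟨s, hs⟩ : ∃ s : ℝ, s = u / (1 - τ) := ⟨_, rfl⟩
  rw [← hτ] at hτ1 hτ2 h1τ
  have hsu : s * (1 - τ) = u := by rw [hs]; exact div_mul_cancel₀ u h1τ.ne'
  have hu' : u * (1 - z.re) = -z.im := by rw [hu]; exact div_mul_cancel₀ (-z.im) h1x.ne'
  have hτ' : τ * (1 - z.re) = z.re * (1 - z.re) - z.im ^ 2 := by
    rw [hτ, sub_mul, div_mul_cancel₀ _ h1x.ne']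
  refine ⟨s, Real.arsinh (τ / Real.sqrt (1 - τ ^ 2)), ?_⟩
  rw [orbit_mul, orbit_hyp, tanh_arsinh_div_sqrt hτ2 hτ1]
  show mobius (mat (unip s)) (τ : ℂ) = z
  rw [mobius_unip_apply]
  have hden : (s : ℂ) * I * (τ : ℂ) + (1 - (s : ℂ) * I) ≠ 0 := by
    intro h0
    have := congrArg Complex.re h0
    simp at this
  rw [div_eq_iff hden, Complex.ext_iff]
  simp
  constructor
  · have key : (τ - (z.re - z.im * (s * τ + -s))) * (1 - z.re) = 0 := by
      linear_combination hτ' - z.im * hu' - z.im * (1 - z.re) * hsu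
    exact sub_eq_zero.1 ((mul_eq_zero.1 key).resolve_right h1x.ne')
  · linear_combination (-1 : ℝ) * hu' - (1 - z.re) * hsu

/-! ### The Iwasawa decomposition -/

/-- **`G = N A K`**: every `g ∈ SU(1,1)` is `n_s a_t rot u`. -/
theorem exists_unip_mul_hyp_mul_rot (g : SU11) :
    ∃ (s t : ℝ) (u : Circle), g = unip s * hyp t * rot u := by
  obtain ⟨s, t, hst⟩ := exists_orbit_unip_mul_hyp_eq (orbit_mem_ball g)
  have h0 : orbit ((unip s * hyp t)⁻¹ * g) = 0 := by
    have e1 : orbit ((unip s * hyp t)⁻¹ * g) =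
        orbit ((unip s * hyp t)⁻¹ * (unip s * hyp t)) := by
      rw [orbit_mul, orbit_mul, hst]
    rw [e1, inv_mul_cancel, orbit_one]
  obtain ⟨u, hu⟩ := exists_rot_of_orbit_eq_zero _ h0
  exact ⟨s, t, u, by rw [← hu, mul_inv_cancel_left]⟩

/-- **`G = K A N`**: every `g ∈ SU(1,1)` is `rot u a_t n_s`. -/
theorem exists_rot_mul_hyp_mul_unip (g : SU11) :
    ∃ (u : Circle) (t s : ℝ), g = rot u * hyp t * unip s := by
  obtain ⟨s, t, u, h⟩ := exists_unip_mul_hyp_mul_rot g⁻¹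
  refine ⟨u⁻¹, -t, -s, ?_⟩
  calc g = (g⁻¹)⁻¹ := (inv_inv g).symm
    _ = (unip s * hyp t * rot u)⁻¹ := by rw [h]
    _ = rot u⁻¹ * hyp (-t) * unip (-s) := by
      rw [hyp_neg, unip_neg, map_inv]
      group

/-- **`G = K · (N A)`** as sets: `SU(1,1) = ⋃_u rot u · (N A)`; the coset form `g = k · b` with `k ∈ K`
and `b = a_t n_s ∈ A N`. -/
theorem exists_rot_mul_mem (g : SU11) :
    ∃ (u : Circle) (b : SU11), (∃ t s : ℝ, b = hyp t * unip s) ∧ g = rot u * b := by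
  obtain ⟨u, t, s, h⟩ := exists_rot_mul_hyp_mul_unip g
  exact ⟨u, hyp t * unip s, ⟨t, s, rfl⟩, by rw [h, mul_assoc]⟩

end Summit.Ventures.HodgeRepro2.T5SU11Iwasawa
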